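import Summits.AtomisticToContinuum.Crystallization.Theorems.OverbindingBudgetAffineTaylorCellAccumulator

/-!
# OverbindingBudget — Taylor-model cells for the far-window certificate, part 4/16 «Soundness»

MODULE PLAN (lens-4 g68, at hand-2's landing-shape request of 2026-09-02T14:19Z, critic row 1199 (II)) of the VERIFIED g67 leaf
`OverbindingBudgetAffineTaylorCell.lean` (sha256 `dabedef39e0c5fd2…`, 4214 l, critic row 1196): this module = leaf l.826–1072
(§4 cell soundness at order 4: per-term enclosure and assembly over the family), body VERBATIM except as listed in `MAP.md`.
Same namespace `…Theorems.OverbindingBudgetAffineTaylorCell` in all 16 parts (declaration names unchanged); the parts import each other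
linearly.  No `sorry`, no `native_decide`, standard axioms; no instances/notation; scoped `set_option maxHeartbeats` with explicit bounds only.
-/

namespace Summit.AtomisticToContinuum.Crystallization.Theorems.OverbindingBudgetAffineTaylorCell

/-! ### Assembly over the family: the cell soundness theorem -/

/-- The true near sum `Σ_N s_N(t)^{-n}` of the family at the box point `t` (`n = m`, i.e. `‖·‖^{-2m}`). -/
noncomputable def Cell.trueSum (C : Cell) (n : ℕ) (vs : List (ℤ × ℤ × ℤ)) (t1 t2 t3 t4 t5 : ℝ) : ℝ :=
  (vs.map fun N => (((C.cOf N.1 N.2.1 N.2.2 : ℝ) + C.linR N.1 N.2.1 N.2.2 t1 t2 t3 t4 t5) ^ n)⁻¹).sum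

/-- The exact model of the family: the sum of the slot polynomials of the terms. -/
def Cell.modelSum (C : Cell) (vs : List (ℤ × ℤ × ℤ)) (t1 t2 t3 t4 t5 : ℝ) : ℝ :=
  (vs.map fun N => C.termModel N.1 N.2.1 N.2.2 t1 t2 t3 t4 t5).sum

/-- `Cell.trueSum_cons` (docstring added by the landing lane; see the module docstring). [formal bookkeeping] -/
theorem Cell.trueSum_cons (C : Cell) (n : ℕ) (N : ℤ × ℤ × ℤ) (vs : List (ℤ × ℤ × ℤ)) (t1 t2 t3 t4 t5 : ℝ) :
    C.trueSum n (N :: vs) t1 t2 t3 t4 t5 =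
      (((C.cOf N.1 N.2.1 N.2.2 : ℝ) + C.linR N.1 N.2.1 N.2.2 t1 t2 t3 t4 t5) ^ n)⁻¹ + C.trueSum n vs t1 t2 t3 t4 t5 := by
  simp [Cell.trueSum]

/-- `Cell.modelSum_cons` (docstring added by the landing lane; see the module docstring). [formal bookkeeping] -/
theorem Cell.modelSum_cons (C : Cell) (N : ℤ × ℤ × ℤ) (vs : List (ℤ × ℤ × ℤ)) (t1 t2 t3 t4 t5 : ℝ) :
    C.modelSum (N :: vs) t1 t2 t3 t4 t5 = C.termModel N.1 N.2.1 N.2.2 t1 t2 t3 t4 t5 + C.modelSum vs t1 t2 t3 t4 t5 := by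
  simp [Cell.modelSum]

/-- Step 1: true sum vs exact model, within the accumulated (rounded-up) remainder. -/
theorem Cell.trueSum_sub_modelSum_m3 (C : Cell) (hm : C.m = 3) (hJ : C.J = 4) (hD : 0 < C.D) (t1 t2 t3 t4 t5 : ℝ)
    (h1 : |t1| ≤ C.h1) (h2 : |t2| ≤ C.h2) (h3 : |t3| ≤ C.h3) (h4 : |t4| ≤ C.h4) (h5 : |t5| ≤ C.h5) :
    ∀ vs : List (ℤ × ℤ × ℤ), (∀ N ∈ vs, 0 < C.cOf N.1 N.2.1 N.2.2 ∧ C.UOf N.1 N.2.1 N.2.2 < 1 / 2) →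
      |C.trueSum 3 vs t1 t2 t3 t4 t5 - C.modelSum vs t1 t2 t3 t4 t5| ≤ ((vs.map C.rr).sum : ℚ) := by
  intro vs
  induction vs with
  | nil => intro _; simp [Cell.trueSum, Cell.modelSum]
  | cons N vs ih =>
    intro hadm
    have hN := hadm N (by simp)
    have hrest := ih (fun M hM => hadm M (by simp [hM]))
    rw [C.trueSum_cons, C.modelSum_cons, List.map_cons, List.sum_cons, Rat.cast_add]
    have hterm := C.term_abs_m3 hm hJ (N.1 : ℚ) (N.2.1 : ℚ) (N.2.2 : ℚ) hN.1 hN.2 t1 t2 t3 t4 t5 h1 h2 h3 h4 h5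
    have hrr : ((C.remQ N.1 N.2.1 N.2.2 : ℚ) : ℝ) ≤ ((C.rr N : ℚ) : ℝ) := by exact_mod_cast C.le_rr hD hN.1
    calc |(((C.cOf N.1 N.2.1 N.2.2 : ℝ) + C.linR N.1 N.2.1 N.2.2 t1 t2 t3 t4 t5) ^ 3)⁻¹ + C.trueSum 3 vs t1 t2 t3 t4 t5
          - (C.termModel N.1 N.2.1 N.2.2 t1 t2 t3 t4 t5 + C.modelSum vs t1 t2 t3 t4 t5)|
        = |((((C.cOf N.1 N.2.1 N.2.2 : ℝ) + C.linR N.1 N.2.1 N.2.2 t1 t2 t3 t4 t5) ^ 3)⁻¹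
            - C.termModel N.1 N.2.1 N.2.2 t1 t2 t3 t4 t5)
            + (C.trueSum 3 vs t1 t2 t3 t4 t5 - C.modelSum vs t1 t2 t3 t4 t5)| := by ring_nf
      _ ≤ _ := abs_add_le _ _
      _ ≤ _ := add_le_add (hterm.trans hrr) hrest

/-- `Cell.trueSum_sub_modelSum_m6` (docstring added by the landing lane; see the module docstring). [formal bookkeeping] -/
theorem Cell.trueSum_sub_modelSum_m6 (C : Cell) (hm : C.m = 6) (hJ : C.J = 4) (hD : 0 < C.D) (t1 t2 t3 t4 t5 : ℝ)
    (h1 : |t1| ≤ C.h1) (h2 : |t2| ≤ C.h2) (h3 : |t3| ≤ C.h3) (h4 : |t4| ≤ C.h4) (h5 : |t5| ≤ C.h5) :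
    ∀ vs : List (ℤ × ℤ × ℤ), (∀ N ∈ vs, 0 < C.cOf N.1 N.2.1 N.2.2 ∧ C.UOf N.1 N.2.1 N.2.2 < 1 / 2) →
      |C.trueSum 6 vs t1 t2 t3 t4 t5 - C.modelSum vs t1 t2 t3 t4 t5| ≤ ((vs.map C.rr).sum : ℚ) := by
  intro vs
  induction vs with
  | nil => intro _; simp [Cell.trueSum, Cell.modelSum]
  | cons N vs ih =>
    intro hadm
    have hN := hadm N (by simp)
    have hrest := ih (fun M hM => hadm M (by simp [hM]))
    rw [C.trueSum_cons, C.modelSum_cons, List.map_cons, List.sum_cons, Rat.cast_add]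
    have hterm := C.term_abs_m6 hm hJ (N.1 : ℚ) (N.2.1 : ℚ) (N.2.2 : ℚ) hN.1 hN.2 t1 t2 t3 t4 t5 h1 h2 h3 h4 h5
    have hrr : ((C.remQ N.1 N.2.1 N.2.2 : ℚ) : ℝ) ≤ ((C.rr N : ℚ) : ℝ) := by exact_mod_cast C.le_rr hD hN.1
    calc |(((C.cOf N.1 N.2.1 N.2.2 : ℝ) + C.linR N.1 N.2.1 N.2.2 t1 t2 t3 t4 t5) ^ 6)⁻¹ + C.trueSum 6 vs t1 t2 t3 t4 t5
          - (C.termModel N.1 N.2.1 N.2.2 t1 t2 t3 t4 t5 + C.modelSum vs t1 t2 t3 t4 t5)|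
        = |((((C.cOf N.1 N.2.1 N.2.2 : ℝ) + C.linR N.1 N.2.1 N.2.2 t1 t2 t3 t4 t5) ^ 6)⁻¹
            - C.termModel N.1 N.2.1 N.2.2 t1 t2 t3 t4 t5)
            + (C.trueSum 6 vs t1 t2 t3 t4 t5 - C.modelSum vs t1 t2 t3 t4 t5)| := by ring_nf
      _ ≤ _ := abs_add_le _ _
      _ ≤ _ := add_le_add (hterm.trans hrr) hrest

/-- Step 2 (swap of the two finite sums): the family model is the slot polynomial with the summed exact coefficients. -/
theorem sum_map_sum_map_mul {ι κ : Type*} (l : List ι) (s : List κ) (f : ι → κ → ℝ) (e : κ → ℝ) :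
    (l.map fun i => (s.map fun k => f i k * e k).sum).sum = (s.map fun k => (l.map fun i => f i k).sum * e k).sum := by
  induction l with
  | nil => simp
  | cons i l ih =>
    rw [List.map_cons, List.sum_cons, ih]
    have : (s.map fun k => ((i :: l).map fun i => f i k).sum * e k) = s.map fun k => f i k * e k + (l.map fun i => f i k).sum * e k := by
      apply List.map_congr_left
      intro k _
      rw [List.map_cons, List.sum_cons, add_mul]
    rw [this, List.sum_map_add]

/-- The exact summed coefficient of slot `mo` (order 4). -/
def Cell.pcoef (C : Cell) (vs : List (ℤ × ℤ × ℤ)) (mo : Mono) : ℚ :=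
  (vs.map fun N => if mo.d < 4 then C.termQ N.1 N.2.1 N.2.2 mo else 0).sum

/-- `Cell.modelSum_eq` (docstring added by the landing lane; see the module docstring). [formal bookkeeping] -/
theorem Cell.modelSum_eq (C : Cell) (vs : List (ℤ × ℤ × ℤ)) (t1 t2 t3 t4 t5 : ℝ) :
    C.modelSum vs t1 t2 t3 t4 t5 = (monos.map fun mo => (C.pcoef vs mo : ℝ) * mo.ev t1 t2 t3 t4 t5).sum := by
  unfold Cell.modelSum Cell.termModel
  rw [sum_map_sum_map_mul]
  congr 1
  apply List.map_congr_left
  intro mo _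
  congr 1
  unfold Cell.pcoef
  rw [Rat.cast_list_sum, List.map_map]
  congr 1
  apply List.map_congr_left
  intro N _
  simp only [Function.comp]
  split_ifs <;> simp

/-- Step 3: the kernel's coefficient of slot `mo` is within `|vs|/D` (below) of the exact one. -/
theorem Cell.rcSum_le (C : Cell) (hJ : C.J = 4) (hD : 0 < C.D) (mo : Mono) :
    ∀ vs : List (ℤ × ℤ × ℤ), (∀ N ∈ vs, 0 < C.cOf N.1 N.2.1 N.2.2 ∧ C.UOf N.1 N.2.1 N.2.2 < 1 / 2) →
      (vs.map fun N => C.rc N mo).sum ≤ C.pcoef vs mo ∧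
        C.pcoef vs mo ≤ (vs.map fun N => C.rc N mo).sum + vs.length / C.D := by
  intro vs
  induction vs with
  | nil => intro _; simp [Cell.pcoef]
  | cons N vs ih =>
    intro hadm
    have hN := hadm N (by simp)
    have hrest := ih (fun M hM => hadm M (by simp [hM]))
    unfold Cell.pcoef at hrest ⊢
    rw [List.map_cons, List.sum_cons, List.map_cons, List.sum_cons, List.length_cons]
    by_cases hd : mo.d < 4
    · rw [if_pos hd]
      have h := C.rc_le hD hN.1 mo (hJ ▸ hd)
      have hD' : (0 : ℚ) < C.D := by exact_mod_cast hD
      constructor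
      · linarith [h.1, hrest.1]
      · have : ((vs.length + 1 : ℕ) : ℚ) / C.D = vs.length / C.D + 1 / C.D := by push_cast; ring
        rw [this]; linarith [h.2, hrest.2]
    · rw [if_neg hd, C.rc_of_ge mo (hJ ▸ hd)]
      have hD' : (0 : ℚ) < C.D := by exact_mod_cast hD
      constructor
      · linarith [hrest.1]
      · have : ((vs.length + 1 : ℕ) : ℚ) / C.D = vs.length / C.D + 1 / C.D := by push_cast; ring
        rw [this]
        have : (0 : ℚ) ≤ 1 / C.D := by positivity
        linarith [hrest.2]

/-- `|t^α| ≤ 1` on a box inside the unit cube. -/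
theorem Mono.ev_abs_le_one (mo : Mono) (t1 t2 t3 t4 t5 : ℝ)
    (h1 : |t1| ≤ 1) (h2 : |t2| ≤ 1) (h3 : |t3| ≤ 1) (h4 : |t4| ≤ 1) (h5 : |t5| ≤ 1) :
    |mo.ev t1 t2 t3 t4 t5| ≤ 1 := by
  unfold Mono.ev
  rw [abs_mul, abs_mul, abs_mul, abs_mul, abs_pow, abs_pow, abs_pow, abs_pow, abs_pow]
  have p1 : |t1| ^ mo.e1 ≤ 1 := pow_le_one₀ (abs_nonneg _) h1
  have p2 : |t2| ^ mo.e2 ≤ 1 := pow_le_one₀ (abs_nonneg _) h2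
  have p3 : |t3| ^ mo.e3 ≤ 1 := pow_le_one₀ (abs_nonneg _) h3
  have p4 : |t4| ^ mo.e4 ≤ 1 := pow_le_one₀ (abs_nonneg _) h4
  have p5 : |t5| ^ mo.e5 ≤ 1 := pow_le_one₀ (abs_nonneg _) h5
  have q12 := mul_le_one₀ p1 (by positivity) p2
  have q123 := mul_le_one₀ q12 (by positivity) p3
  have q1234 := mul_le_one₀ q123 (by positivity) p4
  exact mul_le_one₀ q1234 (by positivity) p5

/-- Step 4: two slot polynomials with coefficientwise-close coefficients are close on the unit box. -/
theorem slotPoly_sub_le {κ : Type*} (s : List κ) (a b : κ → ℝ) (e : κ → ℝ) (B : ℝ)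
    (hab : ∀ k ∈ s, |a k - b k| ≤ B) (he : ∀ k ∈ s, |e k| ≤ 1) :
    |(s.map fun k => a k * e k).sum - (s.map fun k => b k * e k).sum| ≤ s.length * B := by
  induction s with
  | nil => simp
  | cons k s ih =>
    have hk := hab k (by simp)
    have hek := he k (by simp)
    have hrest := ih (fun j hj => hab j (by simp [hj])) (fun j hj => he j (by simp [hj]))
    rw [List.map_cons, List.sum_cons, List.map_cons, List.sum_cons, List.length_cons]
    push_cast
    have hB : 0 ≤ B := (abs_nonneg _).trans hk
    calc |a k * e k + (s.map fun k => a k * e k).sum - (b k * e k + (s.map fun k => b k * e k).sum)|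
        = |(a k - b k) * e k + ((s.map fun k => a k * e k).sum - (s.map fun k => b k * e k).sum)| := by ring_nf
      _ ≤ |(a k - b k) * e k| + |(s.map fun k => a k * e k).sum - (s.map fun k => b k * e k).sum| := abs_add_le _ _
      _ ≤ B * 1 + s.length * B := by
          refine add_le_add ?_ hrest
          rw [abs_mul]; exact mul_le_mul hk hek (abs_nonneg _) hB
      _ = (s.length + 1) * B := by ring

/-- `monos_length` (docstring added by the landing lane; see the module docstring). [formal bookkeeping] -/
theorem monos_length : monos.length = 126 := by simp [monos]

/-- The kernel polynomial in closed form. -/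
theorem Cell.evalCoef_acc (C : Cell) (vs : List (ℤ × ℤ × ℤ)) (t1 t2 t3 t4 t5 : ℝ) :
    evalCoef (C.acc vs).coef t1 t2 t3 t4 t5 =
      (monos.map fun mo => (((vs.map fun N => C.rc N mo).sum : ℚ) : ℝ) * mo.ev t1 t2 t3 t4 t5).sum := by
  unfold evalCoef
  rw [C.acc_coef, zipWith_map_self]

/-- CELL SOUNDNESS (`m = 3`, order `J = 4`): on the whole box `|t_i| ≤ h_i` (`h_i ≤ 1`), the kernel polynomial is within
`rem + 126·|vs|/D` of the true near sum `Σ_N s_N(t)^{-3}` of the (admissible, `ok = true`) family. -/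
theorem Cell.acc_sound_m3_J4 (C : Cell) (hm : C.m = 3) (hJ : C.J = 4) (hD : 0 < C.D)
    (hh1 : C.h1 ≤ 1) (hh2 : C.h2 ≤ 1) (hh3 : C.h3 ≤ 1) (hh4 : C.h4 ≤ 1) (hh5 : C.h5 ≤ 1)
    (vs : List (ℤ × ℤ × ℤ)) (hok : (C.acc vs).ok = true) (t1 t2 t3 t4 t5 : ℝ)
    (h1 : |t1| ≤ C.h1) (h2 : |t2| ≤ C.h2) (h3 : |t3| ≤ C.h3) (h4 : |t4| ≤ C.h4) (h5 : |t5| ≤ C.h5) :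
    |C.trueSum 3 vs t1 t2 t3 t4 t5 - evalCoef (C.acc vs).coef t1 t2 t3 t4 t5|
      ≤ ((C.acc vs).rem : ℝ) + 126 * (vs.length / C.D : ℚ) := by
  have hadm := (C.acc_ok_iff vs).1 hok
  have s1 := C.trueSum_sub_modelSum_m3 hm hJ hD t1 t2 t3 t4 t5 h1 h2 h3 h4 h5 vs hadm
  rw [← C.acc_rem] at s1
  have s2 : |C.modelSum vs t1 t2 t3 t4 t5 - evalCoef (C.acc vs).coef t1 t2 t3 t4 t5| ≤ 126 * (vs.length / C.D : ℚ) := by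
    rw [C.modelSum_eq, C.evalCoef_acc]
    have h := slotPoly_sub_le monos (fun mo => (C.pcoef vs mo : ℝ)) (fun mo => (((vs.map fun N => C.rc N mo).sum : ℚ) : ℝ))
      (fun mo => mo.ev t1 t2 t3 t4 t5) ((vs.length / C.D : ℚ) : ℝ) ?_ ?_
    · simpa [monos_length] using h
    · intro mo _
      have hb := C.rcSum_le hJ hD mo vs hadm
      rw [abs_le]
      constructor
      · have : (((vs.map fun N => C.rc N mo).sum : ℚ) : ℝ) ≤ (C.pcoef vs mo : ℝ) := by exact_mod_cast hb.1
        have h0 : (0 : ℝ) ≤ ((vs.length / C.D : ℚ) : ℝ) := by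
          have : (0 : ℚ) ≤ vs.length / C.D := by positivity
          exact_mod_cast this
        linarith
      · have : (C.pcoef vs mo : ℝ) ≤ (((vs.map fun N => C.rc N mo).sum : ℚ) : ℝ) + ((vs.length / C.D : ℚ) : ℝ) := by
          exact_mod_cast hb.2
        linarith
    · intro mo _
      exact mo.ev_abs_le_one t1 t2 t3 t4 t5 (h1.trans (by exact_mod_cast hh1)) (h2.trans (by exact_mod_cast hh2))
        (h3.trans (by exact_mod_cast hh3)) (h4.trans (by exact_mod_cast hh4)) (h5.trans (by exact_mod_cast hh5))
  calc |C.trueSum 3 vs t1 t2 t3 t4 t5 - evalCoef (C.acc vs).coef t1 t2 t3 t4 t5|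
      = |(C.trueSum 3 vs t1 t2 t3 t4 t5 - C.modelSum vs t1 t2 t3 t4 t5)
          + (C.modelSum vs t1 t2 t3 t4 t5 - evalCoef (C.acc vs).coef t1 t2 t3 t4 t5)| := by ring_nf
    _ ≤ _ := abs_add_le _ _
    _ ≤ _ := add_le_add s1 s2

/-- CELL SOUNDNESS (`m = 6`, order `J = 4`). -/
theorem Cell.acc_sound_m6_J4 (C : Cell) (hm : C.m = 6) (hJ : C.J = 4) (hD : 0 < C.D)
    (hh1 : C.h1 ≤ 1) (hh2 : C.h2 ≤ 1) (hh3 : C.h3 ≤ 1) (hh4 : C.h4 ≤ 1) (hh5 : C.h5 ≤ 1)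
    (vs : List (ℤ × ℤ × ℤ)) (hok : (C.acc vs).ok = true) (t1 t2 t3 t4 t5 : ℝ)
    (h1 : |t1| ≤ C.h1) (h2 : |t2| ≤ C.h2) (h3 : |t3| ≤ C.h3) (h4 : |t4| ≤ C.h4) (h5 : |t5| ≤ C.h5) :
    |C.trueSum 6 vs t1 t2 t3 t4 t5 - evalCoef (C.acc vs).coef t1 t2 t3 t4 t5|
      ≤ ((C.acc vs).rem : ℝ) + 126 * (vs.length / C.D : ℚ) := by
  have hadm := (C.acc_ok_iff vs).1 hok
  have s1 := C.trueSum_sub_modelSum_m6 hm hJ hD t1 t2 t3 t4 t5 h1 h2 h3 h4 h5 vs hadm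
  rw [← C.acc_rem] at s1
  have s2 : |C.modelSum vs t1 t2 t3 t4 t5 - evalCoef (C.acc vs).coef t1 t2 t3 t4 t5| ≤ 126 * (vs.length / C.D : ℚ) := by
    rw [C.modelSum_eq, C.evalCoef_acc]
    have h := slotPoly_sub_le monos (fun mo => (C.pcoef vs mo : ℝ)) (fun mo => (((vs.map fun N => C.rc N mo).sum : ℚ) : ℝ))
      (fun mo => mo.ev t1 t2 t3 t4 t5) ((vs.length / C.D : ℚ) : ℝ) ?_ ?_
    · simpa [monos_length] using h
    · intro mo _
      have hb := C.rcSum_le hJ hD mo vs hadm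
      rw [abs_le]
      constructor
      · have : (((vs.map fun N => C.rc N mo).sum : ℚ) : ℝ) ≤ (C.pcoef vs mo : ℝ) := by exact_mod_cast hb.1
        have h0 : (0 : ℝ) ≤ ((vs.length / C.D : ℚ) : ℝ) := by
          have : (0 : ℚ) ≤ vs.length / C.D := by positivity
          exact_mod_cast this
        linarith
      · have : (C.pcoef vs mo : ℝ) ≤ (((vs.map fun N => C.rc N mo).sum : ℚ) : ℝ) + ((vs.length / C.D : ℚ) : ℝ) := by
          exact_mod_cast hb.2
        linarith
    · intro mo _
      exact mo.ev_abs_le_one t1 t2 t3 t4 t5 (h1.trans (by exact_mod_cast hh1)) (h2.trans (by exact_mod_cast hh2))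
        (h3.trans (by exact_mod_cast hh3)) (h4.trans (by exact_mod_cast hh4)) (h5.trans (by exact_mod_cast hh5))
  calc |C.trueSum 6 vs t1 t2 t3 t4 t5 - evalCoef (C.acc vs).coef t1 t2 t3 t4 t5|
      = |(C.trueSum 6 vs t1 t2 t3 t4 t5 - C.modelSum vs t1 t2 t3 t4 t5)
          + (C.modelSum vs t1 t2 t3 t4 t5 - evalCoef (C.acc vs).coef t1 t2 t3 t4 t5)| := by ring_nf
    _ ≤ _ := abs_add_le _ _
    _ ≤ _ := add_le_add s1 s2

end Summit.AtomisticToContinuum.Crystallization.Theorems.OverbindingBudgetAffineTaylorCell
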